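import Literature.AlgebraicGeometry.Frobenioids.BirationalizationCategoryTheoreticity
import Literature.AlgebraicGeometry.Frobenioids.BirationalizationRigidity
import Literature.AlgebraicGeometry.Frobenioids.EquivalencePreStepsQuasiIsotropic
import HarnessLib

/-!
# Frobenioids I, Corollary 4.10 AS TYPED, at THE birationalizations — assembly

Mochizuki, *The geometry of Frobenioids I: the general theory*, Kyushu J. Math. **62** (2008)
293–400, Cor. 4.10, kurims text pp. 90–91 [cite: MochizukiFrdI2008, Cor. 4.10 p.90].

PROOF-ONLY assembly (seat abc-iut-L1-t10 gen 2; piece FrdI:Cor4.10 under abc-iut-L1-t14's row): the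
typed node statement `PreFrobenioidData.Cor410` (seat abc-iut-L1-t3) at THE birationalizations
`PreFrobenioid.biratData hF_i hsq_i` (seats abc-iut-L6-t8 / L6-t6) — the `1`-unique `1`-commutative square
from `BirationalizationCategoryTheoreticity.lean` and the rigidity clause from
`BirationalizationRigidity.lean` (`isRigidFunctor_toBirat`: `D₂` slim, `C₂` of birationally
Frobenius-normalized type ⇒ `C₂ → C₂^birat` rigid) — MODULO ONLY the printed input "`Ψ` preserves
co-angular pre-steps [cf. Theorem 3.4, (ii)]" (hypotheses `hΨ`, `hΨ'`, for `Ψ` and its quasi-inverse;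
named fact of seat abc-iut-L1-t13) — `cor410_biratData`; and UNCONDITIONALLY over bases of FSM-type —
`cor410_biratData_of_isOfFSMType` — where that input is seat abc-iut-L1-t13's PROVED repaired Thm. 3.4 (ii)
(`EquivalencePreStepsQuasiIsotropic.lean`). No statement of the paper is restated or strengthened.
-/

namespace Literature.AlgebraicGeometry.Frobenioids

open CategoryTheory

universe w₁ v₁ v₁' u₁ u₁' w₂ v₂ v₂' u₂ u₂'

namespace PreFrobenioid

variable {D₁ : Type u₁} [Category.{v₁} D₁] {Φ₁ : D₁ᵒᵖ ⥤ CommMonCat.{w₁}}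
  {C₁ : Type u₁'} [Category.{v₁'} C₁] {F₁ : C₁ ⥤ ElemFrobenioid Φ₁}
  {D₂ : Type u₂} [Category.{v₂} D₂] {Φ₂ : D₂ᵒᵖ ⥤ CommMonCat.{w₂}}
  {C₂ : Type u₂'} [Category.{v₂'} C₂] {F₂ : C₂ ⥤ ElemFrobenioid Φ₂}

/-- **[FrdI] Corollary 4.10 (Category-theoreticity of the Birationalization), AS TYPED**
(`PreFrobenioidData.Cor410`) at THE birationalizations of two Frobenioids: a `1`-unique `Ψ^birat`
making the square `1`-commute, an equivalence, and — for `D₁, D₂` slim and `C₁, C₂` of birationally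
Frobenius-normalized type — rigidity of both composite functors; from the printed input "`Ψ` [and a
quasi-inverse] preserves co-angular pre-steps [cf. Theorem 3.4, (ii)]" (`hΨ`, `hΨ'`).
[cite: MochizukiFrdI2008, Cor. 4.10 p.90] -/
theorem cor410_biratData (hF₁ : IsFrobenioid F₁) (hsq₁ : HasBiratSquares F₁)
    (hF₂ : IsFrobenioid F₂) (hsq₂ : HasBiratSquares F₂) (Ψ : C₁ ≌ C₂)
    (hΨ : ∀ ⦃A B : C₁⦄ (f : A ⟶ B), IsCoAngularPreStep F₁ f → IsCoAngularPreStep F₂ (Ψ.functor.map f))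
    (hΨ' : ∀ ⦃A B : C₂⦄ (f : A ⟶ B), IsCoAngularPreStep F₂ f → IsCoAngularPreStep F₁ (Ψ.inverse.map f)) :
    PreFrobenioidData.Cor410 (PreFrobenioidData.ofFunctor Φ₁ F₁) (PreFrobenioidData.ofFunctor Φ₂ F₂) Ψ
      (biratData hF₁ hsq₁) (biratData hF₂ hsq₂) :=
  cor410_biratData_of_isRigid hF₁ hsq₁ hF₂ hsq₂ Ψ hΨ hΨ'
    (fun hD₂ hN₂ => isRigidFunctor_toBirat hF₂ hsq₂ hD₂ hN₂)

end PreFrobenioid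

namespace PreFrobenioid

variable {D₁ : Type u₁} [Category.{v₁} D₁] {Φ₁ : D₁ᵒᵖ ⥤ CommMonCat.{w₁}}
  {C₁ : Type u₁'} [Category.{v₁'} C₁] {F₁ : C₁ ⥤ ElemFrobenioid Φ₁}
  {D₂ : Type u₁} [Category.{v₁} D₂] {Φ₂ : D₂ᵒᵖ ⥤ CommMonCat.{w₁}}
  {C₂ : Type u₁'} [Category.{v₁'} C₂] {F₂ : C₂ ⥤ ElemFrobenioid Φ₂}

/-- **[FrdI] Corollary 4.10 AS TYPED — UNCONDITIONAL over bases of FSM-type**: for Frobenioids `C₁`,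
`C₂` (of quasi-isotropic type, an antecedent of the typed statement) over bases `D₁`, `D₂` of FSM-type and
any equivalence `Ψ : C₁ ⥲ C₂`, the typed `Cor410` holds at THE birationalizations — the Thm. 3.4 (ii) input
"`Ψ` preserves co-angular pre-steps" being DISCHARGED by seat abc-iut-L1-t13's
`FrdI.isCoAngularPreStep_map_of_quasiIsotropic_of_isOfFSMType` (the cell's repaired Thm. 3.4 (ii):
FSM-type bases in place of print's FSMFF-type; `IsOfFSMType.isOfFSMFFType`). The two sides live in
common universes here (as in that theorem). [cite: MochizukiFrdI2008, Cor. 4.10 p.90] -/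
theorem cor410_biratData_of_isOfFSMType (hF₁ : IsFrobenioid F₁) (hsq₁ : HasBiratSquares F₁)
    (hF₂ : IsFrobenioid F₂) (hsq₂ : HasBiratSquares F₂) (hD₁ : IsOfFSMType D₁) (hD₂ : IsOfFSMType D₂)
    (Ψ : C₁ ≌ C₂) :
    PreFrobenioidData.Cor410 (PreFrobenioidData.ofFunctor Φ₁ F₁) (PreFrobenioidData.ofFunctor Φ₂ F₂) Ψ
      (biratData hF₁ hsq₁) (biratData hF₂ hsq₂) := by
  intro hff₁ hff₂ hq₁ hq₂
  exact cor410_biratData hF₁ hsq₁ hF₂ hsq₂ Ψ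
    (fun _ _ _ hf => FrdI.isCoAngularPreStep_map_of_quasiIsotropic_of_isOfFSMType hF₁ hF₂ hq₁ hq₂ hD₂ Ψ hf)
    (fun _ _ _ hf =>
      FrdI.isCoAngularPreStep_map_of_quasiIsotropic_of_isOfFSMType hF₂ hF₁ hq₂ hq₁ hD₁ Ψ.symm hf)
    hff₁ hff₂ hq₁ hq₂

end PreFrobenioid

end Literature.AlgebraicGeometry.Frobenioids
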